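import Literature.AlgebraicGeometry.Resolution.QuadraticTransformsUFD
import Mathlib.RingTheory.Ideal.KrullsHeightTheorem
import HarnessLib

/-!
# Crux `PatchingRelPerfect` (stmt-ResolutionOfSingularities-16161), chain W5.2 — F7(β) (β-AX) X3 C-I (M2b-T), (T-h-alg): THE KRULL BRICK of the
# 𝒳-package — a component of a hypersurface through a regular parameter is the parameter΄s hypersurface (`…DepthPhaseCContactKrull`)

[OURS · L1 W5.2 · F7(β) (β-AX) X3 C-I (M2b-T) · `D/res-D-repro-1/M2bT-ASSEMBLY-PLAN.md` (T-h) «the one open technical point», hand res-D-repro-1 AS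
res-L1-repro-3] The local algebra that closes F-60΄s `hcomp` («no irreducible component of the contact surface `𝒳 = V(f) ⊂ G` lies in a member
trace `V(d)`») from the STALK form (T-f) `germ_prod_not_mem_carrier_sup_member`: at the generic point `η` of such a component the local ring
`R = 𝒪_{G,η}` is regular, its maximal ideal is MINIMAL over `(f)` (η is generic in `V(f)`), and `d ∈ 𝔪 ∖ 𝔪²` (the member trace is a regular
hypersurface through `η`); then KRULL΄s principal ideal theorem gives `ht 𝔪 ≤ 1`, so `R` is a discrete valuation ring, `𝔪 = (d)`, and
`f ∈ (d)` — i.e. the trace `V(d)` is (locally) CONTAINED in `𝒳`, which the stalk NF at `x` forbids after shrinking the patch.  Pure commutative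
algebra, def-free, fact-free; NOT a statement of the manuscript under review; AI-written, weaker than expert review.

## References
* W. Krull, Hauptidealsatz — Mathlib `Ideal.height_le_one_of_isPrincipal_of_mem_minimalPrimes`. [Matsumura1987]
* H. Matsumura, *Commutative Ring Theory* (1987), Thm. 11.2 / Thm. 14.2 (regular local rings of dimension one are DVRs). [Matsumura1987]
-/

-- `Summit.<Summit>.<Sub>.Theorems` with `Sub = Summit` (single-conjunct summit, D-0017)
set_option linter.dupNamespace false

noncomputable section

open IsLocalRing
open Literature.AlgebraicGeometry.Resolution

namespace Summit.ResolutionOfSingularities.ResolutionOfSingularities.Theorems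

namespace ContactKrull

universe u

variable {R : Type u} [CommRing R]

/-- [OURS · L1 W5.2 · (M2b-T) (T-h-alg)] **A regular local ring whose maximal ideal is minimal over a principal ideal has dimension `≤ 1`**
(Krull΄s Hauptidealsatz). [cite: Matsumura1987, Thm. 13.5] -/
theorem ringKrullDim_le_one_of_mem_minimalPrimes [IsRegularLocalRing R] {f : R}
    (hmin : maximalIdeal R ∈ (Ideal.span {f}).minimalPrimes) : ringKrullDim R ≤ 1 := by
  have h := Ideal.height_le_one_of_isPrincipal_of_mem_minimalPrimes (Ideal.span {f}) (maximalIdeal R) hmin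
  rw [← IsLocalRing.maximalIdeal_height_eq_ringKrullDim]
  exact_mod_cast h

/-- [OURS · L1 W5.2 · (M2b-T) (T-h-alg)] **In a regular local ring of dimension `≤ 1`, an element of `𝔪 ∖ 𝔪²` generates `𝔪`.**
[cite: Matsumura1987, Thm. 11.2] -/
theorem maximalIdeal_eq_span_of_not_mem_sq [IsRegularLocalRing R] (hdim : ringKrullDim R ≤ 1) {d : R} (hd : d ∈ maximalIdeal R)
    (hd2 : d ∉ maximalIdeal R ^ 2) : maximalIdeal R = Ideal.span {d} := by
  haveI : IsPrincipalIdealRing R := isPrincipalIdealRing_of_ringKrullDim_le_one hdim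
  obtain ⟨ϖ, hϖ⟩ := (IsPrincipalIdealRing.principal (maximalIdeal R)).principal
  rw [Ideal.submodule_span_eq] at hϖ
  have hdϖ : d ∈ Ideal.span {ϖ} := hϖ ▸ hd
  obtain ⟨a, rfl⟩ := Ideal.mem_span_singleton'.mp hdϖ
  have ha : IsUnit a := by
    by_contra hna
    apply hd2
    rw [pow_two]
    exact Ideal.mul_mem_mul ((mem_maximalIdeal a).mpr hna) (hϖ ▸ Ideal.mem_span_singleton_self ϖ)
  rw [hϖ]
  exact (Ideal.span_singleton_mul_left_unit ha ϖ).symm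

/-- [OURS · L1 W5.2 · (M2b-T) (T-h-alg)] **THE KRULL BRICK**: in a regular local ring, if the maximal ideal is minimal over `(f)` and `d` is a
regular parameter (`d ∈ 𝔪 ∖ 𝔪²`), then `f ∈ (d)` — the hypersurface `V(d)` through the generic point of a component of `V(f)` lies in `V(f)`.
[cite: Matsumura1987, Thm. 13.5, Thm. 11.2] -/
theorem mem_span_singleton_of_mem_minimalPrimes [IsRegularLocalRing R] {f d : R} (hmin : maximalIdeal R ∈ (Ideal.span {f}).minimalPrimes)
    (hd : d ∈ maximalIdeal R) (hd2 : d ∉ maximalIdeal R ^ 2) : f ∈ Ideal.span {d} := by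
  rw [← maximalIdeal_eq_span_of_not_mem_sq (ringKrullDim_le_one_of_mem_minimalPrimes hmin) hd hd2]
  exact hmin.1.2 (Ideal.mem_span_singleton_self f)

/-- [OURS · L1 W5.2 · (M2b-T) (T-h-alg)] Contrapositive, the form the 𝒳-package uses: if `f ∉ (d)` for the regular parameter `d`, then `𝔪` is
NOT minimal over `(f)` — the generic point of the trace `V(d)` is not a generic point of a component of `V(f)`. [cite: Matsumura1987, Thm. 13.5] -/
theorem not_mem_minimalPrimes_of_not_mem_span [IsRegularLocalRing R] {f d : R} (hd : d ∈ maximalIdeal R) (hd2 : d ∉ maximalIdeal R ^ 2)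
    (hf : f ∉ Ideal.span {d}) : maximalIdeal R ∉ (Ideal.span {f}).minimalPrimes :=
  fun hmin => hf (mem_span_singleton_of_mem_minimalPrimes hmin hd hd2)

end ContactKrull

end Summit.ResolutionOfSingularities.ResolutionOfSingularities.Theorems

end
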